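/-
Copyright (c) 2026 the pub-hodgecm-mathlib formalisation cell (harness21).  Prover seat hodgecm-mathlib-A-p13 (g40), second hand of
LD1-p02 (g4) on the ι-step (P4) of brick (Gα-C∞) `ArchLadder` (line LD1 of crux `HLiu418`; LD1-plan (g2) DEALS #12 (1)), sub-brick (P4c-iii),
2026-09-02.  KERNEL module: THEOREMS ONLY (no definition, no named fact, no `sorry`, no instance, no notation).
-/
import Literature.NumberTheory.GelbartRogawski1991.DoubledWeilRepresentationArchPlaceHermite
import Literature.RepresentationTheory.KonnoKonno2007.JunctionHyperbolicFamily
import HarnessLib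

/-!
# A FIRST-COPY LEVI DILATION IS A BOX OPERATOR: on `frameD^* R_{e₂}(a₁ ⊠ a₂)` the diagonal dilation of the doubled Folland coordinates with
# weights `c` on the first copy and `1` on the second acts through the dilation of weights `c` on the first factor (read through `frameV`)

Topic `NumberTheory/GelbartRogawski1991`; namespace `Literature.NumberTheory.GelbartRogawski1991.GRConstruction` (that of ★ β-II
`DoubledWeilRepresentationArchPlaceHermite`, whose variables `(L) (e) (dV hdV hdV0) (dW hdW hdW0)` and frames `frameD` ∕ `frameV` this file continues).
Cell hodgecm-mathlib FLOOR 0, crux `HLiu418` = stmt-HodgeConjecture-24832, line LD1, brick (Gα-C∞) `ArchLadder`, ι-step (P4) of LD1-p02 (g4)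
(bus 2026-09-02T10:25:17Z cut (P4a)–(P4d); sub-brick (P4c-iii) offered 10:44:57Z, taken by A-p13 (g40)).  The hyperbolic one-parameter family of the real
pair is `hypOp = μ₀(frameU)⁻¹ ∘ leviS (planeDil) ∘ μ₀(frameU)` (★ `KonnoKonno2007.JunctionHyperbolicFamily`); ★ (P4c-ii) `…ArchPlaceBoxOperators` reads the two
`μ₀` factors on box tensors, this file reads the Levi dilation.

* §1 `det_diagEquiv`, `leviFactor_diagEquiv_doubled` — the normalising factor `|det|^{-1/2}` (★ `leviFactor`, [Folland1989, (4.24)]) of the doubled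
  dilation `diag(c ⊔ 1)` equals that of `diag(c)` (the second copy carries weight `1`).
* §2 **`leviS_diagEquiv_doubled_schwartzTransport_frameD`** — for `c : Fin n × places → ℝ` nowhere `0` and ALL `a₁ a₂ ∈ 𝓢((K ⊗ ℝ)^{Fin n})`,
  `leviS (diag(c on copy 1, 1 on copy 2)) (frameD^* R_{e₂}(a₁ ⊠ a₂)) = frameD^* R_{e₂}((frameV^*)⁻¹ (leviS (diag c) (frameV^* a₁)) ⊠ a₂)` — pointwise:
  `frameD` has the scale of `frameV` on BOTH copies (★ `signVec_doubled_inl ∕ _inr`), so the dilated doubled coordinates split into the dilated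
  first-copy coordinates and the untouched second-copy ones.

HONEST SCOPE.  Frame bookkeeping in the Schwartz model ([Folland1989, §1.3 (1.25), §4.2 (4.24)]); nothing of [Liu2021] or [GelbartRogawski1991] is
asserted.  HC_CM is proved only modulo the 7 printed citations (2 remaining: hLiu418 = stmt-HodgeConjecture-24832, h413 = stmt-HodgeConjecture-24833)
until rung 0 closes; this file books nothing and discharges nothing booked (a `--supports` helper of line LD1).

## References
* [Folland1989] G. B. Folland, *Harmonic Analysis in Phase Space*, Princeton UP (1989), §1.3 (1.25) (linear changes of coordinates), §4.2 (4.24)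
  (the Levi dilations `|det A|^{-1/2} f(A⁻¹ x)` of the Siegel parabolic).
* [HarrisKudlaSweet1996] M. Harris, S. Kudla, W. Sweet, J. AMS 9 (1996), §1 (1.9) (the doubled space `𝕍 ⊕ (−𝕍)`).
-/

set_option autoImplicit false

noncomputable section

open scoped Classical
open scoped Matrix Kronecker TensorProduct SchwartzMap
open NumberField NumberField.InfinitePlace NumberField.mixedEmbedding IsDedekindDomain
open Literature.RepresentationTheory.HeisenbergGroup
open Literature.NumberTheory.Automorphic
open Literature.NumberTheory.Weil1964
open Literature.RepresentationTheory.HarrisKudlaSweet1996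
open Literature.NumberTheory.GaloisRepresentations
open Literature.Analysis.SegalBargmann

namespace Literature.NumberTheory.GelbartRogawski1991.GRConstruction

open UnitaryDualPair UnitaryDualPair.ArchSplitting
open Literature.NumberTheory.GelbartRogawski1991.UnitaryDualPair.LocalSplitting
open Literature.RepresentationTheory Literature.RepresentationTheory.KonnoKonno2007 Literature.RepresentationTheory.KonnoKonno2007.RealDualPair
open MvPolynomial

variable (L : Type) [Field L] [NumberField L] [IsCMField L]

variable {N M n : ℕ} (e : Fin N × Fin M ≃ Fin n)
  (dV : Fin N → L) (hdV : ∀ i, IsCMField.complexConj L (dV i) = dV i) (hdV0 : ∀ i, dV i ≠ 0)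
  (dW : Fin M → L) (hdW : ∀ i, IsCMField.complexConj L (dW i) = dW i) (hdW0 : ∀ i, dW i ≠ 0)

/-! ## §1 The Levi factor of the doubled dilation -/

/-- `det (diag c) = ∏ c` (★ `RealDualPair.toMatrix'_diagLin`). [cite: Folland1989, §4.2 (4.24)] -/
theorem det_diagEquiv {σ : Type} [Fintype σ] [DecidableEq σ] (c : σ → ℝ) (hc : ∀ k, c k ≠ 0) :
    LinearMap.det ((RealDualPair.diagEquiv c hc : (σ → ℝ) ≃ₗ[ℝ] (σ → ℝ)) : (σ → ℝ) →ₗ[ℝ] (σ → ℝ)) = ∏ k, c k := by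
  have h : ((RealDualPair.diagEquiv c hc : (σ → ℝ) ≃ₗ[ℝ] (σ → ℝ)) : (σ → ℝ) →ₗ[ℝ] (σ → ℝ)) = RealDualPair.diagLin c := rfl
  rw [← LinearMap.det_toMatrix', h, RealDualPair.toMatrix'_diagLin, Matrix.det_diagonal]

omit [NumberField L] [IsCMField L] in
/-- the doubled weights «`c` on the first copy, `1` on the second» do not vanish. [cite: Folland1989, §4.2 (4.24)] -/
theorem doubledWeight_ne_zero (c : Fin n × {v : InfinitePlace (Fp L) // v.IsReal} → ℝ) (hc : ∀ k, c k ≠ 0) :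
    ∀ k : Fin (n + n) × {v : InfinitePlace (Fp L) // v.IsReal},
      Sum.elim (fun i : Fin n => c (i, k.2)) (fun _ : Fin n => (1 : ℝ)) ((e₂ (n := n)).symm k.1) ≠ 0 := by
  intro k
  rcases h : (e₂ (n := n)).symm k.1 with i | i
  · rw [Sum.elim_inl]
    exact hc _
  · rw [Sum.elim_inr]
    exact one_ne_zero

omit [IsCMField L] in
/-- **the Levi factors agree**: `|det diag(c ⊔ 1)|^{-1/2} = |det diag(c)|^{-1/2}` (the second copy carries weight `1`).
[cite: Folland1989, §4.2 (4.24)] -/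
theorem leviFactor_diagEquiv_doubled (c : Fin n × {v : InfinitePlace (Fp L) // v.IsReal} → ℝ) (hc : ∀ k, c k ≠ 0) :
    leviFactor (RealDualPair.diagEquiv
        (fun k : Fin (n + n) × {v : InfinitePlace (Fp L) // v.IsReal} =>
          Sum.elim (fun i : Fin n => c (i, k.2)) (fun _ : Fin n => (1 : ℝ)) ((e₂ (n := n)).symm k.1))
        (doubledWeight_ne_zero L c hc)) =
      leviFactor (RealDualPair.diagEquiv c hc) := by
  rw [leviFactor, leviFactor, det_diagEquiv, det_diagEquiv]
  congr 3
  -- `∏_{(k,v)} (c ⊔ 1)(e₂⁻¹ k, v) = ∏_{(i,v)} c (i,v)`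
  rw [← Fintype.prod_equiv ((e₂ (n := n)).prodCongr (Equiv.refl {v : InfinitePlace (Fp L) // v.IsReal}))
      (fun s : (Fin n ⊕ Fin n) × {v : InfinitePlace (Fp L) // v.IsReal} =>
        Sum.elim (fun i : Fin n => c (i, s.2)) (fun _ : Fin n => (1 : ℝ)) s.1) _
      (fun s => by
        obtain ⟨s₁, s₂⟩ := s
        simp only [Equiv.prodCongr_apply, Prod.map_apply, Equiv.coe_refl, id_eq, Equiv.symm_apply_apply]),
    Fintype.prod_prod_type, Fintype.prod_sum_type, Fintype.prod_prod_type]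
  simp only [Sum.elim_inl, Sum.elim_inr, Finset.prod_const_one, mul_one]

/-! ## §2 The first-copy Levi dilation is a box operator -/

/-- **A FIRST-COPY LEVI DILATION IS A BOX OPERATOR.**  For `c : Fin n × places → ℝ` nowhere `0` and all `a₁ a₂ ∈ 𝓢((K ⊗ ℝ)^{Fin n})`:
`leviS (diag(c ⊔ 1)) (frameD^* R_{e₂}(a₁ ⊠ a₂)) = frameD^* R_{e₂}((frameV^*)⁻¹ (leviS (diag c) (frameV^* a₁)) ⊠ a₂)` — the doubled Folland frame
`frameD` has the scale of `frameV` on both copies (★ `signVec_doubled_inl ∕ _inr`), so dilating the doubled coordinates by `(c, 1)` dilates the first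
copy by `c` and fixes the second; the two Levi factors agree (§1). [cite: Folland1989, §1.3 (1.25), §4.2 (4.24)] [cite: HarrisKudlaSweet1996, §1 (1.9)] -/
theorem leviS_diagEquiv_doubled_schwartzTransport_frameD (c : Fin n × {v : InfinitePlace (Fp L) // v.IsReal} → ℝ) (hc : ∀ k, c k ≠ 0)
    (a₁ a₂ : 𝓢(((Fin n) → mixedSpace (Fp L)), ℂ)) :
    leviS (RealDualPair.diagEquiv
        (fun k : Fin (n + n) × {v : InfinitePlace (Fp L) // v.IsReal} =>
          Sum.elim (fun i : Fin n => c (i, k.2)) (fun _ : Fin n => (1 : ℝ)) ((e₂ (n := n)).symm k.1))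
        (doubledWeight_ne_zero L c hc))
        (schwartzTransport (frameD L e dV hdV hdV0 dW hdW hdW0)
          (schwartzReindexCLM (Fp L) (e₂ (n := n)) (archBoxTensor a₁ a₂))) =
      schwartzTransport (frameD L e dV hdV hdV0 dW hdW hdW0)
        (schwartzReindexCLM (Fp L) (e₂ (n := n))
          (archBoxTensor
            ((schwartzTransport (frameV L e dV hdV hdV0 dW hdW hdW0)).symm
              (leviS (RealDualPair.diagEquiv c hc) (schwartzTransport (frameV L e dV hdV hdV0 dW hdW hdW0) a₁)))
            a₂)) := by
  haveI := isEmpty_isComplex (F := Fp L)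
  ext x
  rw [leviS_apply, schwartzTransport_apply, schwartzReindexCLM_apply, archBoxTensor_apply, schwartzTransport_apply,
    schwartzReindexCLM_apply, archBoxTensor_apply, schwartzTransport_symm_apply, leviS_apply, schwartzTransport_apply,
    leviFactor_diagEquiv_doubled L c hc, mul_assoc]
  congr 1
  congr 1
  · -- first copy: dilated by `c`
    congr 1
    funext i
    refine Prod.ext (funext fun v => ?_) (funext fun w => ?_)
    · simp only [Function.comp_apply, scaledFrame_symm_apply_fst, RealDualPair.diagEquiv_symm_apply, scaledFrame_apply,
        placeScale, sqrtAbs, Equiv.symm_apply_apply, Sum.elim_inl, signVec_doubled_inl]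
      have hD : Real.sqrt |signVec (cmPlaceOver L) (cmGramEntry L e dV hdV dW hdW) (imagUnit L) v i| ≠ 0 :=
        sqrtAbs_signVec_ne_zero (IsCMField.complexConj_ne_one L) (cmPlaceOver_smul L) (complexConj_imagUnit L) (imagUnit_ne_zero L)
          (cmGramEntry_ne_zero L e dV hdV dW hdW hdV0 hdW0) v i
      field_simp
    · exact isEmptyElim w
  · -- second copy: untouched
    congr 1
    funext i
    refine Prod.ext (funext fun v => ?_) (funext fun w => ?_)
    · simp only [Function.comp_apply, scaledFrame_symm_apply_fst, RealDualPair.diagEquiv_symm_apply, Equiv.symm_apply_apply,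
        Sum.elim_inr, inv_one, one_mul]
    · exact isEmptyElim w

end Literature.NumberTheory.GelbartRogawski1991.GRConstruction

end
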